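import Literature.Algebra.Polynomial.CasasAlvero.Descent
import Mathlib.RingTheory.Nullstellensatz
import Mathlib.Algebra.Algebra.ZMod
import Mathlib.Algebra.Field.ZMod
import HarnessLib

/-!
# Casas-Alvero: ascent from an algebraically closed field (Hilbert's Nullstellensatz)

`Descent.lean` proves that the Casas-Alvero statement `HoldsInDegree · d` DESCENDS along field embeddings
`K →+* L`.  Ascent fails in general (over a small field a Casas-Alvero polynomial needs rational witnesses), but it
holds FROM AN ALGEBRAICALLY CLOSED FIELD: this is the remark closing the proof of [GvBLSW 2007, Prop. 2] ("by base
extension one sees easily that if `X_d × ℚ̄` is empty then so is `X_d(K)` for any field `K` of characteristic `0`,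
and the analogon holds for characteristic `p`"), i.e. Hilbert's Nullstellensatz for the finite-type scheme `X_d`.

* `HoldsInDegree.of_isAlgClosed` — if `k → K` and `k → L` are field homomorphisms with `K` algebraically closed,
  then `HoldsInDegree K d → HoldsInDegree L d`.
* `holdsInDegree_iff_of_isAlgClosed_of_charP` / `_of_charZero` — for two algebraically closed fields of the same
  characteristic the Casas-Alvero statements in degree `d` are EQUIVALENT: `CA_d` in characteristic `p` (or `0`)
  is one well-defined boolean, `X_d(𝔽̄_p) = ∅` in the notation of [GvBLSW 2007].
* `holdsInDegree_of_isAlgClosed_charP` — `CA_d` over ONE algebraically closed field of characteristic `p` gives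
  `CA_d` over EVERY field of characteristic `p` (and likewise in characteristic `0`, from e.g. `ℚ̄` or `ℂ`).

PROOF.  Let `f = ∏_{θ ∈ s} (X - θ)` be monic Casas-Alvero of degree `d` over `L` (wlog algebraically closed, by
descent) with two distinct roots `a ≠ b` and witnesses `w_i ∈ s` (`H^i f (w_i) = 0`, `0 < i < d`).  In the
polynomial ring `k[x_θ (θ ∈ s), z]` consider the generic polynomial `P = ∏_{θ ∈ s} (X - x_θ)` and the ideal `I`
generated by the `H^i P (x_{w_i})` and `(x_a - x_b) z - 1`.  The point `(θ)_θ, (a - b)⁻¹` of `L` kills `I`, so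
`I ≠ ⊤`; by the Nullstellensatz (Mathlib's `MvPolynomial.eq_vanishingIdeal_singleton_of_isMaximal`, for a maximal
ideal above `I`) `I` has a zero `x` in the algebraically closed `k`-algebra `K`.  Specialising `P` at `x` gives a
monic Casas-Alvero polynomial of degree `d` over `K` with the two distinct roots `x_a ≠ x_b` — contradicting
`HoldsInDegree K d`.
-/

noncomputable section

open Polynomial

namespace Literature.Algebra.Polynomial.CasasAlvero

universe u v w

section Generic

variable {R T : Type*} [CommRing R] [CommRing T]

/-- a ring map sends `∏ (X - g θ)` to `∏ (X - ψ (g θ))`. [folklore] -/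
private theorem map_multiset_prod_X_sub_C {α : Type*} (ψ : R →+* T) (s : Multiset α) (g : α → R) :
    ((s.map fun θ => X - C (g θ)).prod).map ψ = (s.map fun θ => X - C (ψ (g θ))).prod := by
  simp only [Polynomial.map_multiset_prod, Multiset.map_map, Function.comp_def, Polynomial.map_sub, map_X, map_C]

/-- a ring map commutes with "evaluate the `i`-th Hasse derivative at a point". [folklore] -/
private theorem map_eval_hasseDeriv (ψ : R →+* T) (i : ℕ) (P : R[X]) (q : R) :
    ψ ((hasseDeriv i P).eval q) = (hasseDeriv i (P.map ψ)).eval (ψ q) := by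
  rw [hasseDeriv_map, eval_map, eval₂_hom]

/-- every member of `t` is a root of `∏_{θ ∈ t} (X - θ)`. [folklore] -/
private theorem eval_multiset_prod_X_sub_C_of_mem {t : Multiset R} {x : R} (hx : x ∈ t) :
    ((t.map fun θ => X - C θ).prod).eval x = 0 := by
  rw [eval_multiset_prod, Multiset.map_map]
  exact Multiset.prod_eq_zero (Multiset.mem_map.mpr ⟨x, hx, by simp⟩)

/-- over a domain, a root of `∏_{θ ∈ t} (X - θ)` is a member of `t`. [folklore] -/
private theorem mem_of_eval_multiset_prod_X_sub_C [IsDomain R] {t : Multiset R} {x : R}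
    (hx : ((t.map fun θ => X - C θ).prod).eval x = 0) : x ∈ t := by
  rw [eval_multiset_prod, Multiset.map_map, Multiset.prod_eq_zero_iff, Multiset.mem_map] at hx
  obtain ⟨θ, hθ, h0⟩ := hx
  simp only [Function.comp, eval_sub, eval_X, eval_C] at h0
  rwa [← sub_eq_zero.mp h0] at hθ

end Generic

section Ascent

variable {k : Type u} {K : Type v} {L : Type w} [Field k] [Field K] [IsAlgClosed K] [Field L]

/-- **Ascent from an algebraically closed field, target algebraically closed.**  `k → K`, `k → L` field maps,
`K` and `L` algebraically closed: `HoldsInDegree K d → HoldsInDegree L d`.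
[cite: GrafVonBothmerEtAl2007, Prop. 2] -/
theorem HoldsInDegree.of_isAlgClosed_of_isAlgClosed [IsAlgClosed L] (φ : k →+* K) (ψ : k →+* L) {d : ℕ}
    (h : HoldsInDegree K d) : HoldsInDegree L d := by
  classical
  letI : Algebra k K := φ.toAlgebra
  letI : Algebra k L := ψ.toAlgebra
  intro f hf hfd hca
  rcases Nat.eq_zero_or_pos d with rfl | hdpos
  · exact ⟨0, by rw [pow_zero]; exact (Monic.natDegree_eq_zero hf).mp hfd⟩
  -- roots and factorisation of `f`
  set s : Multiset L := f.roots with hs_def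
  have hcard : Multiset.card s = d := by rw [hs_def, IsAlgClosed.card_roots_eq_natDegree, hfd]
  have hprod : (s.map fun a => X - C a).prod = f :=
    prod_multiset_X_sub_C_of_monic_of_roots_card_eq hf (by rw [IsAlgClosed.card_roots_eq_natDegree])
  by_contra hne
  -- two distinct roots `a ≠ b`
  have h2 : ∃ a ∈ s, ∃ b ∈ s, a ≠ b := by
    by_contra hall
    push Not at hall
    have hs0 : s ≠ 0 := by
      intro h0; rw [h0, Multiset.card_zero] at hcard; omega
    obtain ⟨θ, hθ⟩ := Multiset.exists_mem_of_ne_zero hs0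
    apply hne
    refine ⟨θ, ?_⟩
    have hrep : s = Multiset.replicate d θ :=
      Multiset.eq_replicate.mpr ⟨hcard, fun b hb => (hall b hb θ hθ)⟩
    rw [← hprod, hrep, Multiset.map_replicate, Multiset.prod_replicate]
  obtain ⟨a, ha, b, hb, hab⟩ := h2
  -- witnesses `w i ∈ s`
  have hw : ∀ i, 0 < i → i < d → ∃ x, x ∈ s ∧ (hasseDeriv i f).eval x = 0 := by
    intro i hi0 hi
    obtain ⟨x, hxf, hxH⟩ := hca i hi0 (by rw [hfd]; exact hi)
    exact ⟨x, mem_of_eval_multiset_prod_X_sub_C (by rw [hprod]; exact hxf), hxH⟩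
  choose! w hw using hw
  -- the generic polynomial over `k[x_θ, z]`
  let σ := {x // x ∈ s.toFinset} ⊕ Unit
  let v : L → MvPolynomial σ k := fun x => if hx : x ∈ s.toFinset then MvPolynomial.X (Sum.inl ⟨x, hx⟩) else 0
  let P : (MvPolynomial σ k)[X] := (s.map fun θ => X - C (v θ)).prod
  let E : ℕ → MvPolynomial σ k := fun i => (hasseDeriv i P).eval (v (w i))
  let G : MvPolynomial σ k := (v a - v b) * MvPolynomial.X (Sum.inr ()) - 1
  let S : Set (MvPolynomial σ k) := insert G (E '' Set.Ioo 0 d)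
  let I : Ideal (MvPolynomial σ k) := Ideal.span S
  -- the `L`-point
  let y : σ → L := fun o => Sum.elim (fun x => x.1) (fun _ => (a - b)⁻¹) o
  have hyv : ∀ x ∈ s, MvPolynomial.aeval y (v x) = x := by
    intro x hx
    simp only [v, dif_pos (Multiset.mem_toFinset.mpr hx), MvPolynomial.aeval_X, y, Sum.elim_inl]
  have hPy : P.map (MvPolynomial.aeval y).toRingHom = f := by
    rw [map_multiset_prod_X_sub_C, ← hprod]
    apply congrArg; apply Multiset.map_congr rfl
    intro x hx
    rw [AlgHom.toRingHom_eq_coe, RingHom.coe_coe, hyv x hx]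
  have hIy : ∀ q ∈ I, MvPolynomial.aeval y q = 0 := by
    intro q hq
    refine Submodule.span_induction ?_ ?_ ?_ ?_ hq
    · intro q hq
      rcases hq with rfl | ⟨i, hi, rfl⟩
      · have := hyv a ha; have := hyv b hb
        simp only [G, map_sub, map_mul, map_one, MvPolynomial.aeval_X, y, Sum.elim_inr, hyv a ha, hyv b hb]
        rw [mul_inv_cancel₀ (sub_ne_zero.mpr hab), sub_self]
      · change (MvPolynomial.aeval y).toRingHom ((hasseDeriv i P).eval (v (w i))) = 0
        rw [map_eval_hasseDeriv, hPy]
        have : (MvPolynomial.aeval y).toRingHom (v (w i)) = w i := by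
          rw [AlgHom.toRingHom_eq_coe, RingHom.coe_coe, hyv _ (hw i hi.1 hi.2).1]
        rw [this]
        exact (hw i hi.1 hi.2).2
    · exact map_zero _
    · intro p q _ _ hp hq; rw [map_add, hp, hq, add_zero]
    · intro r p _ hp; rw [smul_eq_mul, map_mul, hp, mul_zero]
  have hI : I ≠ ⊤ := by
    intro htop
    have h1 : MvPolynomial.aeval y (1 : MvPolynomial σ k) = 0 := hIy 1 (htop ▸ Submodule.mem_top)
    rw [map_one] at h1
    exact one_ne_zero h1
  -- Nullstellensatz: a `K`-point of `I`
  obtain ⟨M, hM, hIM⟩ := Ideal.exists_le_maximal I hI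
  obtain ⟨x, hx⟩ := MvPolynomial.eq_vanishingIdeal_singleton_of_isMaximal K hM
  have hIx : ∀ q ∈ I, MvPolynomial.aeval x q = 0 := by
    intro q hq
    have hqM : q ∈ MvPolynomial.vanishingIdeal k {x} := hx ▸ hIM hq
    exact (MvPolynomial.mem_vanishingIdeal_singleton_iff x q).mp hqM
  -- the specialised polynomial over `K`
  let χ : MvPolynomial σ k →+* K := (MvPolynomial.aeval x).toRingHom
  set t : Multiset K := s.map fun θ => χ (v θ) with ht_def
  set fK : K[X] := (t.map fun θ => X - C θ).prod with hfK_def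
  have hPx : P.map χ = fK := by
    rw [map_multiset_prod_X_sub_C, hfK_def, ht_def, Multiset.map_map]; rfl
  have hfK_monic : fK.Monic := monic_multiset_prod_of_monic _ _ fun θ _ => monic_X_sub_C θ
  have hfK_deg : fK.natDegree = d := by
    rw [hfK_def, natDegree_multiset_prod_X_sub_C_eq_card, ht_def, Multiset.card_map, hcard]
  have hfK_ca : IsCasasAlvero fK := by
    intro i hi0 hi
    rw [hfK_deg] at hi
    refine ⟨χ (v (w i)), ?_, ?_⟩
    · exact eval_multiset_prod_X_sub_C_of_mem (Multiset.mem_map.mpr ⟨w i, (hw i hi0 hi).1, rfl⟩)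
    · rw [← hPx, ← map_eval_hasseDeriv]
      exact hIx _ (Ideal.subset_span (Set.mem_insert_of_mem _ ⟨i, ⟨hi0, hi⟩, rfl⟩))
  obtain ⟨c, hc⟩ := h fK hfK_monic hfK_deg hfK_ca
  -- all roots of `fK = (X - c)^d` equal `c`; but `x_a ≠ x_b`
  have hroot : ∀ θ ∈ s, χ (v θ) = c := by
    intro θ hθ
    have h0 : fK.eval (χ (v θ)) = 0 :=
      eval_multiset_prod_X_sub_C_of_mem (Multiset.mem_map.mpr ⟨θ, hθ, rfl⟩)
    rw [hc, eval_pow, eval_sub, eval_X, eval_C] at h0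
    exact sub_eq_zero.mp ((pow_eq_zero_iff hdpos.ne').mp h0)
  have hG : χ G = 0 := hIx G (Ideal.subset_span (Set.mem_insert _ _))
  simp only [G, map_sub, map_mul, map_one, hroot a ha, hroot b hb, sub_self, zero_mul, zero_sub,
    neg_eq_zero, one_ne_zero] at hG

/-- **Ascent from an algebraically closed field** [GvBLSW 2007, proof of Prop. 2, last paragraph; = Hilbert's
Nullstellensatz for `X_d`]: if `k → K` and `k → L` are field homomorphisms and `K` is algebraically closed, then the
Casas-Alvero statement in degree `d` over `K` implies it over `L`. [cite: GrafVonBothmerEtAl2007, Prop. 2] -/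
theorem HoldsInDegree.of_isAlgClosed (φ : k →+* K) (ψ : k →+* L) {d : ℕ} (h : HoldsInDegree K d) :
    HoldsInDegree L d :=
  HoldsInDegree.descend (algebraMap L (AlgebraicClosure L))
    (HoldsInDegree.of_isAlgClosed_of_isAlgClosed φ ((algebraMap L (AlgebraicClosure L)).comp ψ) h)

end Ascent

section Characteristic

/-- `CA_d` over ONE algebraically closed field of characteristic `p` gives `CA_d` over EVERY field of
characteristic `p` (`X_d(𝔽̄_p) = ∅ ⟹ X_d(F) = ∅`). [cite: GrafVonBothmerEtAl2007, Prop. 2] -/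
theorem holdsInDegree_of_isAlgClosed_charP (p : ℕ) [Fact p.Prime] {K : Type v} [Field K] [IsAlgClosed K]
    [CharP K p] {d : ℕ} (h : HoldsInDegree K d) (F : Type w) [Field F] [CharP F p] : HoldsInDegree F d :=
  HoldsInDegree.of_isAlgClosed (k := ZMod p) (ZMod.castHom (dvd_refl p) K) (ZMod.castHom (dvd_refl p) F) h

/-- `CA_d` over ONE algebraically closed field of characteristic `0` (e.g. `ℚ̄` or `ℂ`) gives `CA_d` over EVERY
field of characteristic `0`. [cite: GrafVonBothmerEtAl2007, Prop. 2] -/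
theorem holdsInDegree_of_isAlgClosed_charZero {K : Type v} [Field K] [IsAlgClosed K] [CharZero K] {d : ℕ}
    (h : HoldsInDegree K d) (F : Type w) [Field F] [CharZero F] : HoldsInDegree F d :=
  HoldsInDegree.of_isAlgClosed (Rat.castHom K) (Rat.castHom F) h

/-- For algebraically closed fields of the same prime characteristic the Casas-Alvero statements are equivalent:
`CA_d` in characteristic `p` is a well-defined boolean. [cite: GrafVonBothmerEtAl2007, Prop. 2] -/
theorem holdsInDegree_iff_of_isAlgClosed_of_charP (p : ℕ) [Fact p.Prime] (K : Type v) (L : Type w) [Field K]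
    [IsAlgClosed K] [CharP K p] [Field L] [IsAlgClosed L] [CharP L p] (d : ℕ) :
    HoldsInDegree K d ↔ HoldsInDegree L d :=
  ⟨fun h => holdsInDegree_of_isAlgClosed_charP p h L, fun h => holdsInDegree_of_isAlgClosed_charP p h K⟩

/-- For algebraically closed fields of characteristic `0` the Casas-Alvero statements are equivalent (so the
conjecture over `ℂ`, over `ℚ̄` and over all fields of characteristic `0` are the same statement).
[cite: GrafVonBothmerEtAl2007, Prop. 2] -/
theorem holdsInDegree_iff_of_isAlgClosed_of_charZero (K : Type v) (L : Type w) [Field K] [IsAlgClosed K]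
    [CharZero K] [Field L] [IsAlgClosed L] [CharZero L] (d : ℕ) : HoldsInDegree K d ↔ HoldsInDegree L d :=
  ⟨fun h => holdsInDegree_of_isAlgClosed_charZero h L, fun h => holdsInDegree_of_isAlgClosed_charZero h K⟩

/-- The algebraic closure of any one field of characteristic `p` decides `CA_d` in characteristic `p`:
`CA_d(F̄) → CA_d(F')` for every field `F'` of the same prime characteristic. [cite: GrafVonBothmerEtAl2007, Prop. 2] -/
theorem holdsInDegree_of_algebraicClosure_charP (p : ℕ) [Fact p.Prime] (F : Type v) [Field F] [CharP F p] {d : ℕ}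
    (h : HoldsInDegree (AlgebraicClosure F) d) (F' : Type w) [Field F'] [CharP F' p] : HoldsInDegree F' d := by
  haveI : CharP (AlgebraicClosure F) p := (Algebra.charP_iff F (AlgebraicClosure F) p).mp inferInstance
  exact holdsInDegree_of_isAlgClosed_charP p h F'

end Characteristic

end Literature.Algebra.Polynomial.CasasAlvero
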